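import Summits.QuantumFields.YangMills.Theorems.BalabanUVNodesN20KeyReadingRoadUnderPrefix
import Summits.QuantumFields.YangMills.Theorems.BalabanUVNodesN20WindowKeyBudget

/-!
# BalabanUVNodes ∕ N20·N21·N19′ — module 13Y: THE WINDOW-KEY-CORE CARD's BILL, COMPOSED TO THE ITEM.  For every key reading `kr`: K3⁸
# `Theses.BalabanUVNodes.SpineGivenEndpointR13SepCoPHV` BY NAME from the keyed live line and, per slot tuple INSIDE ITS TUNING WINDOW, the crux card's letters — EITHER the
# young-gap letter in the ℓ¹ currency «the two one-sided ℓ¹ class-matching sums of the `kr`-coarse weights are within `C·θ^K·Σ_{m ≤ j⋆ K}(L⁴∕θ)^m` of the totals» under the card's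
# FRACTION CONDITION on the window width `j⋆` (then NO (AC) letter is needed: bad classes fold into shells), OR the card's own pair (YG) «zero-shell core on the good coarse classes with
# radius `δSF + budget`» + (AC) «a summable weight on the bad ones» + `Summable δSF` + the fraction condition — this lineage's module 12 (the card's P1 `WindowLemma`) ∘ module 13X

Cell `pub-ymgap` (HUMAN RULING D-0062 Track A; D-0149 width push), seat `pub-ymgap-dag-n20-w3` (WIDTH SEAT 3 of 3 on NODE n20 = NE7b) gen 9, CLAIM-4 ∕ INTENT-4
(pub-ymgap INBOX l.39976).  Filed `--kind proof --supports stmt-QuantumFields-27366 --as helper` (K3⁸, skeleton v6 b4e55110ab73e679; dag-lead KEY MAP v2).  COUNT-NEUTRAL.  ADDITIVE —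
imports this lineage's module 13X `…N20KeyReadingRoadUnderPrefix` (gen 9, p642780: `spineGivenEndpointR13SepCoPHV_of_liveLine_of_fscL1LetterK`,
`…_of_liveLine_of_fscCoreLetterK_of_relWeightBoundK` — the key-reading road under the item's own prefix) and module 12 `…N20WindowKeyBudget` (gen 5, p606497, Mathlib-only:
`windowBudget_nonneg`, `summable_windowBudget_of_fraction` = the card's P1 `WindowLemma`, `summable_radius_of_fraction` = the card's `WindowRoadOutput` radius) — BY NAME; nothing of the
card's sketch `Cruxes/SpineGivenEndpointR13SepCoPH/WindowKeyCoreSketch.lean` (`windowBudget`, `FractionCondition`, `YoungGap`, `AgeCutWeight`) is imported or re-declared: the budget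
and the fraction condition are written INLINE exactly as module 12 writes them.  Inside the theses cone (via `K3V5Defs`) like 13V ∕ 13W ∕ 13X.
[III] = [Balaban1988Convergent], [LF-II] = [Balaban1989LargeFieldII], [I] = [Balaban1987RG1] (locations only).

WHY.  The crux card `Ideas/window-key-core.md` (ym-nodeO-idea-3) proposes: key N19′ at Bałaban's 𝐑-window `wkey`, where the unbooked two-run gap per unit volume is the WINDOW
BUDGET `C·θ^K·Σ_{m ≤ j⋆(K)} (L⁴∕θ)^m` (pending blocks of age `m` number `≲ L^{4m}`, each carrying a young increment `≲ C·θ^{K−m}`), summable iff the window is a small FRACTION of `K`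
([III] p.244 «their number is a small fraction of the number K»; the card's `FractionCondition`); the over-aged keys are RARE and booked by N20's weight face ((AC), [LF-II] (1.80) p.384).
Its «Assembly sketch: X ⇒ the crux» was words + Sketch2's definitional `example`.  Module 12 proved the series facts; module 13X reads the item at any key reading under its own prefix.
THIS FILE composes them — the card's X ⇒ the ITEM, BY NAME, for every `kr` (the card's value being `kr := wkey`):
* ★★★ `spineGivenEndpointR13SepCoPHV_of_liveLine_of_fscWindowBudgetL1LetterK` — (YG) IN THE ℓ¹ CURRENCY: per slot tuple, (B) ∕ END in hand, inside the window, ∀ os: SOME `C ≥ 0`,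
  `L > 1`, `0 < θ < 1`, width `j⋆` with the fraction condition, constants `c`, such that the one-sided ℓ¹ mismatch sums of the `kr`-coarse weights modulo `e^{∓c_K}` are ≤ budget × totals
  ⇒ K3⁸.  NO (AC): in the ℓ¹ currency the bad coarse classes are part of the mismatch ∕ the shells (dag-n19-w1's fold); NO K4; NO `W + Wsh < 1` row.
* ★★★ `spineGivenEndpointR13SepCoPHV_of_liveLine_of_fscYoungGapK_of_ageCutWeightK` — THE CARD's OWN PAIR at `(kr, bd)`: (YGₖᵣ) ONE centre per step sandwiching the GOOD coarse
  classes' weights up to `exp(±F.side⁴·(δSF_K + budget_K))` (`δSF` = node U6's geometric small-field channel, summable), ZERO shells + (ACₖᵣ) a `RelWeightBound` witness on the `bd`-bad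
  coarse classes + the fraction condition ⇒ K3⁸ (`summable_radius_of_fraction`, then 13X).
* ★★ `spineGivenEndpointR13SepCoPHV_of_liveLine_of_fscPolyLogWindowBudgetL1LetterK` — the POLY-LOGARITHMIC window `j⋆ K ≤ a + b·(log (K+1))^p` (Bałaban's own shape per the card,
  [LF-II] (1.80)): module 12's `summable_windowBudget_of_le_pow_log` in place of the fraction condition — no fraction bookkeeping.
LOCATED (said, not decided): with 13X ∕ 13Y the window-key-core card is a COMPLETE conditional road TO THE ITEM modulo exactly its declared letters — K1 (YG) at `wkey`, K2 (AC) at `wkey`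
(ℓ¹ form: K1 alone), K3∕D1 the VALUE `wkey`∕`j⋆` with the fraction condition — and modulo NOTHING of the v6 text (no pin, no prefix-free face, no K4).  Whether (YG)∕(AC) hold for
Bałaban's runs at any window is the two-run content print does not state.

HONEST FRAMING.  By-name composition of two LANDED files on hypothesis SHAPES; proves NO estimate; (YG) ∕ (AC) ∕ the fraction condition ∕ `δSF` at a key reading are the card's
HYPOTHESES — NOT PRINTED for `d = 4` as two-run statements ([III] p.244 and [LF-II] (1.80) p.384 LOCATE the window; they do not state the matching), produced by nobody, inhabited for
no Bałaban family today (K0⁷ `Record13SepCoPHInhabited` OPEN); the live line is a HYPOTHESIS; NOT a proof of `stub_expansion13HV` nor of K3⁸ (the theorems conclude the decl BY NAME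
from DISPLAYED hypotheses — `proof.conditional`, credits nothing); nothing of Bałaban's asserted; NE7 ∕ NE7b ∕ NE7c NOT PROVED; N19 ∕ N20 ∕ N21 ∕ N27x NOT discharged; K3⁸ OPEN, v6
STANDS, no v7 proposed; counts unmoved (typed 28∕28 · discharged 5∕27); no count claim.  One finite `𝕋⁴_{L^K}` programme at fixed `ε = L^{−K}`, Bałaban AS PRINTED — R4 closes the
conditional finite-𝕋⁴ rung `BalabanLadder.UV` only; the YM mass gap (Clay) is NOT proved by any of this; NOT ℝ⁴, NOT continuum, NOT OS.  No `def`, no `instance`, no `notation`, no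
`sorry`, no private decls.  Sources (location only): [III] p.244; [LF-II] (1.80) p.384; [I] Thm 2 p.259.
-/

noncomputable section

open Finset Filter
open scoped BigOperators

namespace Summit.QuantumFields.YangMills.BalabanUVNodes.N20WindowRoadBillUnderPrefix

open Literature.MathematicalPhysics.QuantumFieldTheory.Balaban1983to89
open Literature.MathematicalPhysics.QuantumFieldTheory.Balaban1983to89.T4Continuum
open Literature.MathematicalPhysics.QuantumFieldTheory.Balaban1983to89.Node00
open T4WeightBudget (RelWeightBound)
open T4ContinuumYM4Torus (ForSmallCouplings)
open Summit.QuantumFields.BalabanUV.T4Continuum.Spine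
open YMDAG.UVSplit hiding SU
open Summit.QuantumFields.YangMills.Theorems.K3V5Defs (LiveSel)
open Summit.QuantumFields.YangMills.BalabanUVNodes.N20WindowKeyBudget (windowBudget_nonneg summable_windowBudget_of_fraction summable_radius_of_fraction
  summable_windowBudget_of_le_pow_log)
open Summit.QuantumFields.YangMills.BalabanUVNodes.N20KeyReadingRoadUnderPrefix

variable (kr : KeyReading₁₃ 2 0)

/-- **★★★ K3⁸ BY NAME FROM THE KEYED LIVE LINE AND THE YOUNG-GAP LETTER IN THE ℓ¹ CURRENCY AT THE KEY READING `kr`, UNDER THE CARD's FRACTION CONDITION** — per slot tuple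
`(F, θ, h, v)` passing the guard and `Admissible`, GIVEN (B) and END at the slot datum, INSIDE ITS TUNING WINDOW, for every `os`: SOME `C ≥ 0`, `L > 1`, `0 < θ < 1`, a window width
`j⋆ : ℕ → ℕ` with `∃ κ ≥ 0, (L⁴∕θ)^κ·θ < 1 ∧ ∀ᶠ K, j⋆ K ≤ κ·K`, and constants `c`, such that on `|t| ≤ 1` the two one-sided ℓ¹ class-matching sums of the `kr`-coarse class weights
modulo `e^{∓c_K}` are at most `C·θ^K·Σ_{m ≤ j⋆ K}(L⁴∕θ)^m` times the coarse totals.  The budget is a summable non-negative fraction (module 12's `summable_windowBudget_of_fraction`,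
`windowBudget_nonneg`), so module 13X's `…_of_liveLine_of_fscL1LetterK` concludes.  NO (AC) letter, NO K4, NO budget row.  Every letter is the card's HYPOTHESIS — NOT a proof of K3⁸
(`proof.conditional`). [cite: Balaban1988Convergent, p.244; Balaban1989LargeFieldII, (1.80) p.384 (the window; templates only)] [bookkeeping] -/
theorem spineGivenEndpointR13SepCoPHV_of_liveLine_of_fscWindowBudgetL1LetterK
    (hlive : ∀ (F : T4Family) (θ : Stage13HParams F 2), θ.Provisos₁₃CoPH F 2 → (θ.ZhUnity F 2 ∧ θ.SlotsNondegenerate₁₃ F 2) → θ.Admissible F 2 →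
      LiveSel F θ ∧ ZetaMeasurable F 2 θ.ζ)
    (hYG : ∀ (F : T4Family) (θ : Stage13HParams F 2) (h : θ.Provisos₁₃SepCoPH F 2) (v : Revision₁₃ F 2 θ h), (θ.ZhUnity F 2 ∧ θ.SlotsNondegenerate₁₃ F 2) → θ.Admissible F 2 →
      B16.EndStatementBPrinted (datumOfRecord₁₃SepCoPHV F 2 θ h v).C → DagBinding.EndpointExistence (datumOfRecord₁₃SepCoPHV F 2 θ h v).C.toB12 →
        ForSmallCouplings (datumOfRecord₁₃SepCoPHV F 2 θ h v) fun g₀ => ∀ os : List (ULoop F),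
          ∃ (C L ϑ : ℝ) (jstar : ℕ → ℕ) (c : ℕ → ℝ), 0 ≤ C ∧ 1 < L ∧ 0 < ϑ ∧ ϑ < 1 ∧
            (∃ κ : ℝ, 0 ≤ κ ∧ (L ^ 4 / ϑ) ^ κ * ϑ < 1 ∧ ∀ᶠ K : ℕ in atTop, (jstar K : ℝ) ≤ κ * K) ∧
            ∀ (K : ℕ) (t : ℝ), |t| ≤ 1 →
              (∑ u ∈ classSetK₁₃ θ 0 g₀ (kr F θ h.toCore g₀ os) K,
                  max 0 (weightAK₁₃ θ h.toCore 0 g₀ os (kr F θ h.toCore g₀ os) K t u - Real.exp (-c K) * weightBK₁₃ θ h.toCore 0 g₀ os (kr F θ h.toCore g₀ os) K t u)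
                ≤ (C * ϑ ^ K * ∑ m ∈ range (jstar K + 1), (L ^ 4 / ϑ) ^ m) * ∑ u ∈ classSetK₁₃ θ 0 g₀ (kr F θ h.toCore g₀ os) K, weightAK₁₃ θ h.toCore 0 g₀ os (kr F θ h.toCore g₀ os) K t u) ∧
              (∑ u ∈ classSetK₁₃ θ 0 g₀ (kr F θ h.toCore g₀ os) K,
                  max 0 (weightBK₁₃ θ h.toCore 0 g₀ os (kr F θ h.toCore g₀ os) K t u - Real.exp (c K) * weightAK₁₃ θ h.toCore 0 g₀ os (kr F θ h.toCore g₀ os) K t u)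
                ≤ (C * ϑ ^ K * ∑ m ∈ range (jstar K + 1), (L ^ 4 / ϑ) ^ m) * ∑ u ∈ classSetK₁₃ θ 0 g₀ (kr F θ h.toCore g₀ os) K, weightBK₁₃ θ h.toCore 0 g₀ os (kr F θ h.toCore g₀ os) K t u)) :
    Summit.QuantumFields.YangMills.Theses.BalabanUVNodes.SpineGivenEndpointR13SepCoPHV := by
  refine spineGivenEndpointR13SepCoPHV_of_liveLine_of_fscL1LetterK kr hlive fun F θ h v hG hθ hB hE => ?_
  refine (hYG F θ h v hG hθ hB hE).mono fun g₀ hg os => ?_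
  obtain ⟨C, L, ϑ, jstar, c, hC, hL, hϑ, hϑ1, hfrac, hl⟩ := hg os
  exact ⟨c, fun K => C * ϑ ^ K * ∑ m ∈ range (jstar K + 1), (L ^ 4 / ϑ) ^ m, fun K => windowBudget_nonneg hC hϑ jstar K,
    summable_windowBudget_of_fraction C L ϑ jstar hC hL hϑ hϑ1 hfrac, hl⟩

variable (bd : BadKeyReading₁₃ 2 0)

/-- **★★★ K3⁸ BY NAME FROM THE KEYED LIVE LINE AND THE CARD's OWN PAIR AT `(kr, bd)` — (YG) YOUNG GAP WITH RADIUS `δSF + budget` ON THE GOOD COARSE CLASSES, (AC) AGE-CUT WEIGHT ON THE BAD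
ONES — UNDER THE FRACTION CONDITION.**  Per slot tuple, (B) ∕ END in hand, inside the window, ∀ os: SOME `C, L, θ, j⋆` as above with the fraction condition, a summable small-field channel
`δSF` (node U6), a weight `W` with `RelWeightBound 1 (classSetK₁₃ … kr) (weightAK₁₃ …) (weightBK₁₃ …) (badClassK₁₃ … bd) W`, and per step ONE centre `c₀` with
`exp(c₀ − F.side⁴·(δSF_K + budget_K))·weightAK₁₃ u ≤ weightBK₁₃ u ≤ exp(c₀ + F.side⁴·(δSF_K + budget_K))·weightAK₁₃ u` on every GOOD coarse class `u`, `|t| ≤ 1` — the card's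
`WindowRoadOutput` shape.  The radius is summable (module 12's `summable_radius_of_fraction`), so module 13X's `…_of_liveLine_of_fscCoreLetterK_of_relWeightBoundK` concludes (zero
shells, `hybridNE7_noShell`).  NO K4, no budget row.  Every letter is the card's HYPOTHESIS — NOT a proof of K3⁸ (`proof.conditional`).
[cite: Balaban1989LargeFieldII, (1.80) p.384; Balaban1988Convergent, p.244 (templates only)] [bookkeeping] -/
theorem spineGivenEndpointR13SepCoPHV_of_liveLine_of_fscYoungGapK_of_ageCutWeightK
    (hlive : ∀ (F : T4Family) (θ : Stage13HParams F 2), θ.Provisos₁₃CoPH F 2 → (θ.ZhUnity F 2 ∧ θ.SlotsNondegenerate₁₃ F 2) → θ.Admissible F 2 →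
      LiveSel F θ ∧ ZetaMeasurable F 2 θ.ζ)
    (hX : ∀ (F : T4Family) (θ : Stage13HParams F 2) (h : θ.Provisos₁₃SepCoPH F 2) (v : Revision₁₃ F 2 θ h), (θ.ZhUnity F 2 ∧ θ.SlotsNondegenerate₁₃ F 2) → θ.Admissible F 2 →
      B16.EndStatementBPrinted (datumOfRecord₁₃SepCoPHV F 2 θ h v).C → DagBinding.EndpointExistence (datumOfRecord₁₃SepCoPHV F 2 θ h v).C.toB12 →
        ForSmallCouplings (datumOfRecord₁₃SepCoPHV F 2 θ h v) fun g₀ => ∀ os : List (ULoop F),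
          letI : DecidableEq (Σ K, SiteSeqKey F (0 + K)) := Classical.decEq _
          ∃ (C L ϑ : ℝ) (jstar : ℕ → ℕ) (δSF W : ℕ → ℝ), 0 ≤ C ∧ 1 < L ∧ 0 < ϑ ∧ ϑ < 1 ∧
            (∃ κ : ℝ, 0 ≤ κ ∧ (L ^ 4 / ϑ) ^ κ * ϑ < 1 ∧ ∀ᶠ K : ℕ in atTop, (jstar K : ℝ) ≤ κ * K) ∧ Summable δSF ∧
            RelWeightBound 1 (classSetK₁₃ θ 0 g₀ (kr F θ h.toCore g₀ os)) (weightAK₁₃ θ h.toCore 0 g₀ os (kr F θ h.toCore g₀ os))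
                (weightBK₁₃ θ h.toCore 0 g₀ os (kr F θ h.toCore g₀ os)) (badClassK₁₃ θ 0 g₀ (kr F θ h.toCore g₀ os) (bd F θ h.toCore g₀ os)) W ∧
            ∀ K : ℕ, ∃ c₀ : ℝ, ∀ t : ℝ, |t| ≤ 1 →
              ∀ u ∈ classSetK₁₃ θ 0 g₀ (kr F θ h.toCore g₀ os) K \ badClassK₁₃ θ 0 g₀ (kr F θ h.toCore g₀ os) (bd F θ h.toCore g₀ os) K t,
                Real.exp (c₀ - (F.side : ℝ) ^ 4 * (δSF K + C * ϑ ^ K * ∑ m ∈ range (jstar K + 1), (L ^ 4 / ϑ) ^ m)) *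
                    weightAK₁₃ θ h.toCore 0 g₀ os (kr F θ h.toCore g₀ os) K t u ≤ weightBK₁₃ θ h.toCore 0 g₀ os (kr F θ h.toCore g₀ os) K t u ∧
                weightBK₁₃ θ h.toCore 0 g₀ os (kr F θ h.toCore g₀ os) K t u ≤
                  Real.exp (c₀ + (F.side : ℝ) ^ 4 * (δSF K + C * ϑ ^ K * ∑ m ∈ range (jstar K + 1), (L ^ 4 / ϑ) ^ m)) *
                    weightAK₁₃ θ h.toCore 0 g₀ os (kr F θ h.toCore g₀ os) K t u) :
    Summit.QuantumFields.YangMills.Theses.BalabanUVNodes.SpineGivenEndpointR13SepCoPHV := by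
  refine spineGivenEndpointR13SepCoPHV_of_liveLine_of_fscCoreLetterK_of_relWeightBoundK kr bd hlive fun F θ h v hG hθ hB hE => ?_
  refine (hX F θ h v hG hθ hB hE).mono fun g₀ hg os => ?_
  letI : DecidableEq (Σ K, SiteSeqKey F (0 + K)) := Classical.decEq _
  obtain ⟨C, L, ϑ, jstar, δSF, W, hC, hL, hϑ, hϑ1, hfrac, hSF, hW, hgood⟩ := hg os
  exact ⟨W, fun K => δSF K + C * ϑ ^ K * ∑ m ∈ range (jstar K + 1), (L ^ 4 / ϑ) ^ m, hW,
    summable_radius_of_fraction C L ϑ jstar δSF hSF hC hL hϑ hϑ1 hfrac, hgood⟩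

/-- **★★ THE POLY-LOGARITHMIC WINDOW — NO FRACTION BOOKKEEPING** (Bałaban's own window shape per the card: [LF-II] (1.80) p.384, a region is pending for `≈ R_j + log_L(size)` steps;
CRIT-1's risk «`sup_j R_j(K)` not `o(K)`» is a growth law of this shape): (YG) in the ℓ¹ currency at `kr` with fraction the window budget of a width `j⋆ K ≤ a + b·(log (K+1))^p`
eventually ⇒ K3⁸ — module 12's `summable_windowBudget_of_le_pow_log` in place of the fraction condition.  NOT a proof of K3⁸ (`proof.conditional`).
[cite: Balaban1989LargeFieldII, (1.80) p.384; Balaban1988Convergent, (1.1) p.244 (location of the letters only)] [bookkeeping] -/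
theorem spineGivenEndpointR13SepCoPHV_of_liveLine_of_fscPolyLogWindowBudgetL1LetterK
    (hlive : ∀ (F : T4Family) (θ : Stage13HParams F 2), θ.Provisos₁₃CoPH F 2 → (θ.ZhUnity F 2 ∧ θ.SlotsNondegenerate₁₃ F 2) → θ.Admissible F 2 →
      LiveSel F θ ∧ ZetaMeasurable F 2 θ.ζ)
    (hYG : ∀ (F : T4Family) (θ : Stage13HParams F 2) (h : θ.Provisos₁₃SepCoPH F 2) (v : Revision₁₃ F 2 θ h), (θ.ZhUnity F 2 ∧ θ.SlotsNondegenerate₁₃ F 2) → θ.Admissible F 2 →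
      B16.EndStatementBPrinted (datumOfRecord₁₃SepCoPHV F 2 θ h v).C → DagBinding.EndpointExistence (datumOfRecord₁₃SepCoPHV F 2 θ h v).C.toB12 →
        ForSmallCouplings (datumOfRecord₁₃SepCoPHV F 2 θ h v) fun g₀ => ∀ os : List (ULoop F),
          ∃ (C L ϑ a b : ℝ) (p : ℕ) (jstar : ℕ → ℕ) (c : ℕ → ℝ), 0 ≤ C ∧ 1 < L ∧ 0 < ϑ ∧ ϑ < 1 ∧
            (∀ᶠ K : ℕ in atTop, (jstar K : ℝ) ≤ a + b * Real.log ((K : ℝ) + 1) ^ p) ∧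
            ∀ (K : ℕ) (t : ℝ), |t| ≤ 1 →
              (∑ u ∈ classSetK₁₃ θ 0 g₀ (kr F θ h.toCore g₀ os) K,
                  max 0 (weightAK₁₃ θ h.toCore 0 g₀ os (kr F θ h.toCore g₀ os) K t u - Real.exp (-c K) * weightBK₁₃ θ h.toCore 0 g₀ os (kr F θ h.toCore g₀ os) K t u)
                ≤ (C * ϑ ^ K * ∑ m ∈ range (jstar K + 1), (L ^ 4 / ϑ) ^ m) * ∑ u ∈ classSetK₁₃ θ 0 g₀ (kr F θ h.toCore g₀ os) K, weightAK₁₃ θ h.toCore 0 g₀ os (kr F θ h.toCore g₀ os) K t u) ∧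
              (∑ u ∈ classSetK₁₃ θ 0 g₀ (kr F θ h.toCore g₀ os) K,
                  max 0 (weightBK₁₃ θ h.toCore 0 g₀ os (kr F θ h.toCore g₀ os) K t u - Real.exp (c K) * weightAK₁₃ θ h.toCore 0 g₀ os (kr F θ h.toCore g₀ os) K t u)
                ≤ (C * ϑ ^ K * ∑ m ∈ range (jstar K + 1), (L ^ 4 / ϑ) ^ m) * ∑ u ∈ classSetK₁₃ θ 0 g₀ (kr F θ h.toCore g₀ os) K, weightBK₁₃ θ h.toCore 0 g₀ os (kr F θ h.toCore g₀ os) K t u)) :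
    Summit.QuantumFields.YangMills.Theses.BalabanUVNodes.SpineGivenEndpointR13SepCoPHV := by
  refine spineGivenEndpointR13SepCoPHV_of_liveLine_of_fscL1LetterK kr hlive fun F θ h v hG hθ hB hE => ?_
  refine (hYG F θ h v hG hθ hB hE).mono fun g₀ hg os => ?_
  obtain ⟨C, L, ϑ, a, b, p, jstar, c, hC, hL, hϑ, hϑ1, hj, hl⟩ := hg os
  exact ⟨c, fun K => C * ϑ ^ K * ∑ m ∈ range (jstar K + 1), (L ^ 4 / ϑ) ^ m, fun K => windowBudget_nonneg hC hϑ jstar K,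
    summable_windowBudget_of_le_pow_log C L ϑ a b p jstar hC hL hϑ hϑ1 hj, hl⟩

end Summit.QuantumFields.YangMills.BalabanUVNodes.N20WindowRoadBillUnderPrefix

end
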